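import Literature.Barriers.CriticalPhenomena.PlaquetteWalkHoleRootExtremeRows
import Literature.Barriers.CriticalPhenomena.PlaquetteWalkAngleCostParity
import Literature.Barriers.CriticalPhenomena.PlaquetteWalkContourSum
import HarnessLib

/-!
# Barrier catalogue (SAWScalingLimit): a wound class-`B2a` walk from a hole root costs at least `5` in the `Z → ∞` limit model
(«WOUND COST ≥ 5»)

Third brick of the «WOUND COST ≥ 5» programme (DESIGN-next b-engine-1 g23 §2.1), after `PlaquetteWalkHoleRootWoundStraddle`
(a wound excursion draws arcs strictly above and strictly below the hole row) and `PlaquetteWalkHoleRootExtremeRows` (the top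
row of a class-`B2a` walk is singly visited, its runs begin and end with turns, exit turn or sideways end). Here:

* the BOTTOM-ROW TWINS (`YBWalk.sOut_eq_N_of_last_in_row`, `YBWalk.exists_S_of_fc_eq`, `YBWalk.eq_of_fc_eq_of_forall_ne_S`,
  `ΩG.forall_bottom_ne_S`, `ΩG.bottom_single_visit`, `ΩG.bottom_exit_or_end`);
* ★ ISOLATED TURNS ARE `u₁`/`u₂` PLAQUETTES (`YBWalk.kindsL_eq_singleton_of_single_visit`: a singly visited plaquette carries
  exactly the kind of its arc; `YBWalk.card_le_cfgCount_add`: a set of `[corner]`/`[coCorner]` plaquettes has at most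
  `n_{u₁} + n_{u₂}` elements; `ΩG.isolated_turn`);
* ★★★ `ΩG.five_le_cost_of_wound`: for a class-`B2a` walk `ω` from the hole root `a = w.side W` (hole plaquette `(w.1 − 1, w.2)`
  absent) whose excursion polygon winds around the midpoint of `a` (`A_J ≠ 0`), `5 ≤ cost (slotOfSide ω.1) ω.2.mids` — the
  top and bottom rows give `2 + 2` isolated turns, or `2 + 1` when the walk ends sideways inside an extreme row (then the end
  `z` is vertical), and COST PARITY (`PlaquetteWalkAngleCostParity.cfgCount_corner_add_coCorner_mod_two`) lifts both cases to
  cost `= n_{u₁} + n_{u₂} + [z vertical] ≥ 5`.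

Scope note. `cost` is the `Z → ∞` order of a walk's term in the cleared vertex functional (`PlaquetteWalkAngleLimitCoefficient`:
`deg term + cost = 4K + 1`); the hypothesis `WoundCostGE 5` of `PlaquetteWalkAngleLimitCoefficientWound` asks this bound of every
wound GROUP member — the class-`B2a` walk handled here, its reversed companion, and (for `NS` groups) the class-`B2b` extension,
whose cost is `cost ω − 2·[ω.1 vertical]`; the extension therefore needs the sharper `cost ω ≥ 7` for wound `NS` walks ending on
a vertical side, which is NOT proved here (b-engine-1 g23 census j271945: minimal wound cost over all members is `≥ 5` at all
15 081 wound cells of 3 364 rooted domains). [GlazmanManolescu2019 §1 Fig. 1, Lemma 2.1, Remark 2.2; Glazman 2015 Lemma 3.1]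
-/

noncomputable section

namespace Literature.Probability.RandomPlanarGeometry.SAW.YangBaxter

open Real
open Literature.Barriers.CriticalPhenomena.PlaquetteWalk

open private fc_fh fc_ne fh_add_Mv three_le_Mv from Literature.Probability.RandomPlanarGeometry.YangBaxterSAWGeneralDomain

namespace YBWalk

variable {D : Set Face} {a z : MidEdge} (γ : YBWalk D a z)

/-! ## The bottom-row twins of the run-end lemmas -/

/-- ★ **EXIT FROM THE BOTTOM ROW IS A TURN**: an inner arc in the bottommost row whose successor lies in a higher row leaves
through `N` and entered through `W` or `E`. [cite: GlazmanManolescu2019, §1, Fig. 1] -/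
theorem sOut_eq_N_of_last_in_row {Y : ℤ} (hY : ∀ j < γ.arcs.length, Y ≤ (γ.fc j).2) {i : ℕ} (hi : i + 1 < γ.arcs.length)
    (h1 : 1 ≤ i) (h : (γ.fc i).2 = Y) (hnext : (γ.fc (i + 1)).2 ≠ Y) :
    γ.sOut i = .N ∧ (γ.sIn i = .W ∨ γ.sIn i = .E) := by
  have hi' : i < γ.arcs.length := by omega
  have hN : γ.sOut i = .N := by
    cases hs : γ.sOut i
    · exact absurd ((γ.fc_succ_row_of_sOut_WE hi (Or.inl hs)).trans h) hnext
    · exact absurd ((γ.fc_succ_row_of_sOut_WE hi (Or.inr hs)).trans h) hnext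
    · exact absurd hs (γ.sOut_ne_S_of_ge hY hi h)
    · rfl
  refine ⟨hN, ?_⟩
  have hne := γ.sIn_ne_sOut hi'
  rw [hN] at hne
  cases hs : γ.sIn i
  · exact Or.inl rfl
  · exact Or.inr rfl
  · exact absurd hs (γ.sIn_ne_S_of_ge hY hi' h1 h)
  · exact absurd hs hne

/-- A turning arc read backwards: entering through `W`/`E` and leaving through `S`/`N` is a corner or co-corner arc.
[cite: GlazmanManolescu2019, §1, Fig. 1 (the arc kinds)] -/
theorem arcKind_ne_straight_of_WE_S {s t : Side} (hs : s = .W ∨ s = .E) (ht : t = .S ∨ t = .N) : arcKind s t ≠ .straight := by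
  rcases hs with rfl | rfl <;> rcases ht with rfl | rfl <;> decide

/-- **Two different arcs in the same plaquette use four pairwise distinct sides; in particular one of them uses `S`** (the twin of
`exists_N_of_fc_eq`). [cite: GlazmanManolescu2019, §1, Fig. 1 (two arcs in a rhombus: the two corner configurations `w₁`, `w₂`)] -/
theorem exists_S_of_fc_eq {i j : ℕ} (hi : i < γ.arcs.length) (hj : j < γ.arcs.length) (hij : i ≠ j) (he : γ.fc i = γ.fc j) :
    γ.sIn i = .S ∨ γ.sOut i = .S ∨ γ.sIn j = .S ∨ γ.sOut j = .S := by
  wlog hlt : i < j generalizing i j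
  · have := this hj hi (Ne.symm hij) he.symm (by omega)
    tauto
  have hj1 : j ≠ i + 1 := by rintro rfl; exact γ.fc_succ_ne hj he
  obtain ⟨hin_i, hout_i⟩ := γ.side_sIn_eq_nth hi
  obtain ⟨hin_j, hout_j⟩ := γ.side_sIn_eq_nth hj
  rw [← he] at hin_j hout_j
  have hsi := γ.sIn_ne_sOut hi
  have hsj : γ.sIn j ≠ γ.sOut j := γ.sIn_ne_sOut hj
  have d1 : γ.sIn i ≠ γ.sIn j := fun e => by
    have := γ.nth_inj (show i ≤ γ.arcs.length by omega) (show j ≤ γ.arcs.length by omega)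
      (hin_i.symm.trans (by rw [e]; exact hin_j)); omega
  have d2 : γ.sIn i ≠ γ.sOut j := fun e => by
    have := γ.nth_inj (show i ≤ γ.arcs.length by omega) (show j + 1 ≤ γ.arcs.length by omega)
      (hin_i.symm.trans (by rw [e]; exact hout_j)); omega
  have d3 : γ.sOut i ≠ γ.sIn j := fun e => by
    have := γ.nth_inj (show i + 1 ≤ γ.arcs.length by omega) (show j ≤ γ.arcs.length by omega)
      (hout_i.symm.trans (by rw [e]; exact hin_j)); omega
  have d4 : γ.sOut i ≠ γ.sOut j := fun e => by
    have := γ.nth_inj (show i + 1 ≤ γ.arcs.length by omega) (show j + 1 ≤ γ.arcs.length by omega)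
      (hout_i.symm.trans (by rw [e]; exact hout_j)); omega
  revert hsi hsj d1 d2 d3 d4
  cases γ.sIn i <;> cases γ.sOut i <;> cases γ.sIn j <;> cases γ.sOut j <;> simp

/-- If no arc of the bottommost row uses the side `S`, every bottom-row plaquette is SINGLY visited (the twin of
`eq_of_fc_eq_of_forall_ne_N`). [cite: GlazmanManolescu2019, §1, Fig. 1] -/
theorem eq_of_fc_eq_of_forall_ne_S {Y : ℤ} (hS : ∀ k < γ.arcs.length, (γ.fc k).2 = Y → γ.sIn k ≠ .S ∧ γ.sOut k ≠ .S)
    {i j : ℕ} (hi : i < γ.arcs.length) (hj : j < γ.arcs.length) (hrow : (γ.fc i).2 = Y) (he : γ.fc i = γ.fc j) : i = j := by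
  by_contra hij
  obtain ⟨h1, h2⟩ := hS i hi hrow
  obtain ⟨h3, h4⟩ := hS j hj (by rw [← he]; exact hrow)
  rcases γ.exists_S_of_fc_eq hi hj hij he with e | e | e | e
  · exact h1 e
  · exact h2 e
  · exact h3 e
  · exact h4 e

/-! ## A singly visited plaquette carries exactly the kind of its arc: an isolated turn is a `[corner]`/`[coCorner]` plaquette -/

/-- The plaquette of the `i`-th arc is a visited plaquette of the mid-edge list. [cite: GlazmanManolescu2019, §1 (Fig. 1); lane plumbing] -/
theorem fc_mem_facesL {i : ℕ} (hi : i < γ.arcs.length) : γ.fc i ∈ facesL γ.mids := by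
  unfold facesL
  rw [List.mem_dedup, List.mem_filterMap]
  exact ⟨γ.arcs[i], List.getElem_mem hi, (γ.arcKindOf_getElem hi).1⟩

/-- The kind of the `i`-th arc is listed for its plaquette. [cite: GlazmanManolescu2019, §1, Fig. 1] -/
theorem arcKind_mem_kindsL {i : ℕ} (hi : i < γ.arcs.length) : arcKind (γ.sIn i) (γ.sOut i) ∈ kindsL γ.mids (γ.fc i) := by
  obtain ⟨hfa, hk⟩ := γ.arcKindOf_getElem hi
  unfold kindsL
  exact List.mem_filterMap.2 ⟨γ.arcs[i], List.getElem_mem hi, by rw [if_pos hfa, hk]⟩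

/-- ★ **A SINGLY VISITED PLAQUETTE CARRIES EXACTLY ONE KIND** — the kind of its unique arc: `kindsL = [arcKind (sIn i) (sOut i)]`.
In particular an isolated turning arc makes its plaquette a `[corner]` (`u₁`) or `[coCorner]` (`u₂`) plaquette.
[cite: GlazmanManolescu2019, §1, Fig. 1 (the local configurations)] -/
theorem kindsL_eq_singleton_of_single_visit {i : ℕ} (hi : i < γ.arcs.length)
    (hs : ∀ j < γ.arcs.length, γ.fc j = γ.fc i → j = i) :
    kindsL γ.mids (γ.fc i) = [arcKind (γ.sIn i) (γ.sOut i)] := by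
  have hmem := γ.arcKind_mem_kindsL hi
  have hlen : (kindsL γ.mids (γ.fc i)).length < 2 := by
    by_contra hge
    obtain ⟨i', j', hij, hj', hfi, hfj⟩ := γ.exists_two_arcs_of_two_le_length_kindsIn (f := γ.fc i) (not_lt.1 hge)
    have e1 := hs i' (by omega) hfi
    have e2 := hs j' hj' hfj
    omega
  generalize hl : kindsL γ.mids (γ.fc i) = l at hmem hlen
  match l, hmem, hlen with
  | [], hmem, _ => exact absurd hmem List.not_mem_nil
  | [κ], hmem, _ => rw [List.mem_singleton.1 hmem]
  | _ :: _ :: _, _, hlen => exact absurd hlen (by simp)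

/-! ## Counting isolated turns -/

/-- **The isolated turns bound `n_{u₁} + n_{u₂}` from below**: any finite set of visited plaquettes with configuration `[corner]`
or `[coCorner]` has at most `cfgCount [corner] + cfgCount [coCorner]` elements. [cite: GlazmanManolescu2019, §1 (Fig. 1, eq. (1): the counts `n_{u₁}`, `n_{u₂}`); lane plumbing] -/
theorem card_le_cfgCount_add (l : List MidEdge) (T : Finset Face)
    (hT : ∀ f ∈ T, f ∈ facesL l ∧ (kindsL l f = [.corner] ∨ kindsL l f = [.coCorner])) :
    T.card ≤ cfgCount l [.corner] + cfgCount l [.coCorner] := by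
  classical
  set T₁ := ((facesL l).filter fun f => kindsL l f = [.corner]).toFinset with hT₁
  set T₂ := ((facesL l).filter fun f => kindsL l f = [.coCorner]).toFinset with hT₂
  have hsub : T ⊆ T₁ ∪ T₂ := by
    intro f hf
    obtain ⟨hm, hk | hk⟩ := hT f hf
    · exact Finset.mem_union_left _ (List.mem_toFinset.2 (List.mem_filter.2 ⟨hm, by simp [hk]⟩))
    · exact Finset.mem_union_right _ (List.mem_toFinset.2 (List.mem_filter.2 ⟨hm, by simp [hk]⟩))
  calc T.card ≤ (T₁ ∪ T₂).card := Finset.card_le_card hsub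
    _ ≤ T₁.card + T₂.card := Finset.card_union_le _ _
    _ ≤ cfgCount l [.corner] + cfgCount l [.coCorner] := by
      unfold cfgCount
      rw [List.countP_eq_length_filter, List.countP_eq_length_filter]
      exact Nat.add_le_add (List.toFinset_card_le _) (List.toFinset_card_le _)

end YBWalk

/-! ## Wound class-`B2a` walks: the bottom row is singly visited, exit turn or end, and the cost bound -/

namespace ΩG

variable {D : Set Face} {w r : Face} {ω : ΩG D (w.side .W) r}

/-- ★ **NO ARC OF A CLASS-`B2a` WALK USES THE `S` SIDE OF A BOTTOM-ROW PLAQUETTE** (the twin of `forall_top_ne_N`): the first arc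
lies in the root plaquette (hole row, above the bottom row), the last would otherwise return to `r` from below the bottom row or
from inside `r`. [cite: GlazmanManolescu2019, §1, Fig. 1; Lemma 2.1] [cite: Glazman2015WeightedSAW, Lemma 3.1 (proof, pp. 6–7)] -/
theorem forall_bottom_ne_S (hh : holeFaceW w ∉ D) (hr : RootedFace D (w.side .W) r) (h : ω.IsB2a) {Y : ℤ}
    (hY : ∀ j < ω.2.arcs.length, Y ≤ (ω.2.fc j).2) (hYw : Y < w.2) :
    ∀ k < ω.2.arcs.length, (ω.2.fc k).2 = Y → ω.2.sIn k ≠ .S ∧ ω.2.sOut k ≠ .S := by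
  intro k hk hrow
  have hlen : 0 < ω.2.arcs.length := by omega
  have h0 : ω.2.fc 0 = w := fc_zero_eq_root w hh ω.2 hlen
  have hk1 : 1 ≤ k := by
    by_contra hlt
    have e0 : k = 0 := by omega
    rw [e0, h0] at hrow; omega
  refine ⟨ω.2.sIn_ne_S_of_ge hY hk hk1 hrow, ?_⟩
  by_cases hlast : k + 1 < ω.2.arcs.length
  · exact ω.2.sOut_ne_S_of_ge hY hlast hrow
  · intro hS
    have hlen1 : k + 1 = ω.2.arcs.length := by omega
    obtain ⟨-, hout⟩ := ω.2.side_sIn_eq_nth hk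
    rw [hlen1, ω.2.nth_length, hS] at hout
    have hF : ω.2.firstHitG < k := by
      by_contra hge
      have := three_le_Mv hr h; have := fh_add_Mv h; unfold ΩG.Mv at *; omega
    have hlastne : ω.2.fc k ≠ r := fc_ne ω hr h hF hk
    have hrle : Y ≤ r.2 := by
      have e := (fc_fh ω hr h).1
      have := hY ω.2.firstHitG (ω.fh_lt h); rwa [e] at this
    rcases hfc : ω.2.fc k with ⟨x, y⟩
    rw [hfc] at hrow hout hlastne
    simp only at hrow
    have e : r.side ω.1 = .slant x y := by rw [← hout]; rfl
    rcases eq_of_side_eq_slant e with ⟨h2, -⟩ | ⟨h2, -⟩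
    · exact hlastne h2.symm
    · have := congrArg Prod.snd h2; simp only at this; omega

/-- ★ **BOTTOM-ROW PLAQUETTES OF A CLASS-`B2a` WALK ARE SINGLY VISITED.** [cite: GlazmanManolescu2019, §1, Fig. 1; Lemma 2.1] -/
theorem bottom_single_visit (hh : holeFaceW w ∉ D) (hr : RootedFace D (w.side .W) r) (h : ω.IsB2a) {Y : ℤ}
    (hY : ∀ j < ω.2.arcs.length, Y ≤ (ω.2.fc j).2) (hYw : Y < w.2) {i j : ℕ} (hi : i < ω.2.arcs.length)
    (hj : j < ω.2.arcs.length) (hrow : (ω.2.fc i).2 = Y) (he : ω.2.fc i = ω.2.fc j) : i = j :=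
  ω.2.eq_of_fc_eq_of_forall_ne_S (forall_bottom_ne_S hh hr h hY hYw) hi hj hrow he

/-- ★★ **EXIT TURN OR END IN THE BOTTOM ROW** (the twin of `top_exit_or_end`): besides the entry turn `i₀`, the LAST arc `i₁ ≥ i₀`
in the bottommost row of a wound class-`B2a` walk EITHER leaves the row through `N` after entering through `W`/`E` — a second
turn, in a different plaquette — OR it is the walk's last arc, ending on a VERTICAL side of `r`, which then lies in the bottom row.
[cite: GlazmanManolescu2019, §1, Fig. 1; Lemma 2.1] [cite: CourantRobbins1958, Ch. V Appendix §2 (the even–odd rule)] -/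
theorem bottom_exit_or_end (hh : holeFaceW w ∉ D) (hr : RootedFace D (w.side .W) r) (h : ω.IsB2a)
    (hA : ω.AJ hr h (toC (midPt (w.side .W))) ≠ 0) :
    ∃ Y : ℤ, Y ≤ w.2 - 1 ∧ (∀ j < ω.2.arcs.length, Y ≤ (ω.2.fc j).2) ∧
      ∃ i₀ i₁, 1 ≤ i₀ ∧ i₀ + 1 < ω.2.arcs.length ∧ (ω.2.fc i₀).2 = Y ∧ ω.2.sIn i₀ = .N ∧ (ω.2.sOut i₀ = .W ∨ ω.2.sOut i₀ = .E) ∧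
        i₀ ≤ i₁ ∧ i₁ < ω.2.arcs.length ∧ (ω.2.fc i₁).2 = Y ∧ (∀ j, i₁ < j → j < ω.2.arcs.length → (ω.2.fc j).2 ≠ Y) ∧
        ((ω.2.sOut i₁ = .N ∧ (ω.2.sIn i₁ = .W ∨ ω.2.sIn i₁ = .E) ∧ i₀ ≠ i₁ ∧ ω.2.fc i₀ ≠ ω.2.fc i₁) ∨
          (i₁ + 1 = ω.2.arcs.length ∧ (ω.1 = .W ∨ ω.1 = .E) ∧ r.2 = Y)) := by
  classical
  obtain ⟨Y, hYw, hY, i₀, hi₀1, hi₀2, hrow₀, hN₀, hWE₀⟩ := exists_bottom_entry_corner hh hr h hA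
  have hex : ∃ n, ∃ i, i < ω.2.arcs.length ∧ (ω.2.fc i).2 = Y ∧ n = ω.2.arcs.length - i :=
    ⟨_, i₀, by omega, hrow₀, rfl⟩
  obtain ⟨i₁, hi₁, hrow₁, hn₁⟩ := Nat.find_spec hex
  have hmax : ∀ j, i₁ < j → j < ω.2.arcs.length → (ω.2.fc j).2 ≠ Y := by
    intro j hj1 hj2 e
    have := Nat.find_min hex (m := ω.2.arcs.length - j) (by omega)
    exact this ⟨j, hj2, e, rfl⟩
  have hi₀le : i₀ ≤ i₁ := by
    by_contra hlt
    exact hmax i₀ (by omega) (by omega) hrow₀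
  have hne := forall_bottom_ne_S hh hr h hY (by omega)
  have hturn : ω.2.sOut i₁ = .N → (ω.2.sIn i₁ = .W ∨ ω.2.sIn i₁ = .E) →
      (ω.2.sOut i₁ = .N ∧ (ω.2.sIn i₁ = .W ∨ ω.2.sIn i₁ = .E) ∧ i₀ ≠ i₁ ∧ ω.2.fc i₀ ≠ ω.2.fc i₁) := by
    intro hN₁ hWE₁
    have hi01 : i₀ ≠ i₁ := by
      rintro rfl
      rcases hWE₁ with e | e <;> rw [hN₀] at e <;> exact absurd e (by decide)
    exact ⟨hN₁, hWE₁, hi01, fun e => hi01 (bottom_single_visit hh hr h hY (by omega) (by omega) hi₁ hrow₀ e)⟩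
  refine ⟨Y, hYw, hY, i₀, i₁, hi₀1, hi₀2, hrow₀, hN₀, hWE₀, hi₀le, hi₁, hrow₁, hmax, ?_⟩
  by_cases hlast : i₁ + 1 < ω.2.arcs.length
  · have hnext : (ω.2.fc (i₁ + 1)).2 ≠ Y := hmax (i₁ + 1) (by omega) hlast
    obtain ⟨hN₁, hWE₁⟩ := ω.2.sOut_eq_N_of_last_in_row hY hlast (by omega) hrow₁ hnext
    exact Or.inl (hturn hN₁ hWE₁)
  · have hlen1 : i₁ + 1 = ω.2.arcs.length := by omega
    obtain ⟨-, hout⟩ := ω.2.side_sIn_eq_nth hi₁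
    rw [hlen1, ω.2.nth_length] at hout
    have hF : ω.2.firstHitG < i₁ := by
      by_contra hge
      have := three_le_Mv hr h; have := fh_add_Mv h; unfold ΩG.Mv at *; omega
    have hlastne : ω.2.fc i₁ ≠ r := fc_ne ω hr h hF hi₁
    obtain ⟨hSin, hSout⟩ := hne i₁ hi₁ hrow₁
    cases hs : ω.2.sOut i₁
    · right
      rw [hs] at hout
      rcases hfc : ω.2.fc i₁ with ⟨x, y⟩
      rw [hfc] at hrow₁ hout hlastne
      simp only at hrow₁
      have e : r.side ω.1 = .vert x y := by rw [← hout]; rfl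
      rcases eq_of_side_eq_vert e with ⟨h2, hz⟩ | ⟨h2, hz⟩
      · exact absurd h2.symm hlastne
      · exact ⟨hlen1, Or.inr hz, by have := congrArg Prod.snd h2; simp only at this; omega⟩
    · right
      rw [hs] at hout
      rcases hfc : ω.2.fc i₁ with ⟨x, y⟩
      rw [hfc] at hrow₁ hout hlastne
      simp only at hrow₁
      have e : r.side ω.1 = .vert (x + 1) y := by rw [← hout]; rfl
      rcases eq_of_side_eq_vert e with ⟨h2, hz⟩ | ⟨h2, hz⟩
      · exact ⟨hlen1, Or.inl hz, by have := congrArg Prod.snd h2; simp only at this; omega⟩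
      · exact absurd (h2.trans (by simp)).symm hlastne
    · exact absurd hs hSout
    · -- the last arc leaves through `N` (returning to `r` from below): it is a TURN
      left
      have hsi := ω.2.sIn_ne_sOut hi₁
      rw [hs] at hsi
      have hWE : ω.2.sIn i₁ = .W ∨ ω.2.sIn i₁ = .E := by
        cases hsi' : ω.2.sIn i₁
        · exact Or.inl rfl
        · exact Or.inr rfl
        · exact absurd hsi' hSin
        · exact absurd hsi' hsi
      obtain ⟨-, h2, h3, h4⟩ := hturn hs hWE
      exact ⟨rfl, h2, h3, h4⟩

/-- A singly visited plaquette whose arc turns is a `[corner]` or a `[coCorner]` plaquette of the walk (an ISOLATED TURN, weight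
`u₁` or `u₂`). [cite: GlazmanManolescu2019, §1, Fig. 1] -/
theorem isolated_turn {i : ℕ} (hi : i < ω.2.arcs.length) (hs : ∀ j < ω.2.arcs.length, ω.2.fc j = ω.2.fc i → j = i)
    (hk : arcKind (ω.2.sIn i) (ω.2.sOut i) ≠ .straight) :
    ω.2.fc i ∈ facesL ω.2.mids ∧ (kindsL ω.2.mids (ω.2.fc i) = [.corner] ∨ kindsL ω.2.mids (ω.2.fc i) = [.coCorner]) := by
  refine ⟨ω.2.fc_mem_facesL hi, ?_⟩
  rw [ω.2.kindsL_eq_singleton_of_single_visit hi hs]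
  have hsd := ω.2.sIn_ne_sOut hi
  revert hk hsd
  cases ω.2.sIn i <;> cases ω.2.sOut i <;> decide

/-- ★★★ **WOUND COST ≥ 5**: every class-`B2a` walk from a hole root `a = w.side W` (hole plaquette `(w.1 − 1, w.2)` absent) that
WINDS around the hole (`A_J(mid a) ≠ 0`) has COST at least `5` in the `Z → ∞` limit model (`cost = n_{u₁} + n_{u₂} + [z vertical]`,
`PlaquetteWalkAngleLimitCoefficient`): the top row and the bottom row of the walk (WOUND STRADDLE, EXTREME ROWS) each carry an entry
turn and an exit turn in singly visited plaquettes — four isolated turns, or three when the walk ENDS sideways in an extreme row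
(at most one of the two rows, and then `z` is vertical) —, and COST PARITY (`cfgCount_corner_add_coCorner_mod_two`: `n_{u₁} + n_{u₂}`
is even iff `z` is vertical) lifts `3 + 1` and `4 + 0` to `5`. Consequently the wound part of the cleared vertex functional has
degree `≤ 4K − 4` (`PlaquetteWalkAngleLimitCoefficientWound`, hypothesis `WoundCostGE 5` for these walks).
[cite: GlazmanManolescu2019, Lemma 2.1; §1, Fig. 1; Remark 2.2] [cite: Glazman2015WeightedSAW, Lemma 3.1]
[cite: CourantRobbins1958, Ch. V Appendix §2 (the even–odd rule)] -/
theorem five_le_cost_of_wound (hh : holeFaceW w ∉ D) (hr : RootedFace D (w.side .W) r) (h : ω.IsB2a)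
    (hA : ω.AJ hr h (toC (midPt (w.side .W))) ≠ 0) : 5 ≤ cost (slotOfSide ω.1) ω.2.mids := by
  classical
  have hcost : cost (slotOfSide ω.1) ω.2.mids =
      cfgCount ω.2.mids [.corner] + cfgCount ω.2.mids [.coCorner] + (1 - slotDeg (slotOfSide ω.1)) := rfl
  -- the top row: entry turn and exit turn (or the sideways end)
  obtain ⟨Y, hYw, hY, i₀, i₁, -, hi₀2, hrow₀, hS₀, hWE₀, -, hi₁, hrow₁, -, halt⟩ := top_exit_or_end hh hr h hA
  have hsv : ∀ i, i < ω.2.arcs.length → (ω.2.fc i).2 = Y → ∀ j < ω.2.arcs.length, ω.2.fc j = ω.2.fc i → j = i :=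
    fun i hi hrow j hj he => (top_single_visit hh hr h hY (by omega) hi hj hrow he.symm).symm
  have hi₀ : i₀ < ω.2.arcs.length := by omega
  have hP₀ := isolated_turn hi₀ (hsv i₀ hi₀ hrow₀)
    (by rw [hS₀]; exact YBWalk.arcKind_ne_straight_of_S_WE (Or.inl rfl) hWE₀)
  obtain ⟨T₁, hT₁P, hT₁row, hT₁card⟩ : ∃ T₁ : Finset Face,
      (∀ f ∈ T₁, f ∈ facesL ω.2.mids ∧ (kindsL ω.2.mids f = [.corner] ∨ kindsL ω.2.mids f = [.coCorner])) ∧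
      (∀ f ∈ T₁, f.2 = Y) ∧ (2 ≤ T₁.card ∨ (1 ≤ T₁.card ∧ (ω.1 = .W ∨ ω.1 = .E) ∧ r.2 = Y)) := by
    rcases halt with ⟨hS₁, hWE₁, -, hfne⟩ | ⟨-, hz, hrY⟩
    · have hP₁ := isolated_turn hi₁ (hsv i₁ hi₁ hrow₁)
        (by rw [hS₁]; exact YBWalk.arcKind_ne_straight_of_WE_S hWE₁ (Or.inl rfl))
      refine ⟨{ω.2.fc i₀, ω.2.fc i₁}, ?_, ?_, Or.inl (by rw [Finset.card_pair hfne])⟩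
      · intro f hf
        rcases Finset.mem_insert.1 hf with rfl | hf
        · exact hP₀
        · rw [Finset.mem_singleton.1 hf]; exact hP₁
      · intro f hf
        rcases Finset.mem_insert.1 hf with rfl | hf
        · exact hrow₀
        · rw [Finset.mem_singleton.1 hf]; exact hrow₁
    · exact ⟨{ω.2.fc i₀}, fun f hf => by rw [Finset.mem_singleton.1 hf]; exact hP₀,
        fun f hf => by rw [Finset.mem_singleton.1 hf]; exact hrow₀, Or.inr ⟨by simp, hz, hrY⟩⟩
  -- the bottom row: the twin
  obtain ⟨Y', hYw', hY', j₀, j₁, -, hj₀2, hrow₀', hN₀, hWE₀', -, hj₁, hrow₁', -, halt'⟩ := bottom_exit_or_end hh hr h hA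
  have hsv' : ∀ i, i < ω.2.arcs.length → (ω.2.fc i).2 = Y' → ∀ j < ω.2.arcs.length, ω.2.fc j = ω.2.fc i → j = i :=
    fun i hi hrow j hj he => (bottom_single_visit hh hr h hY' (by omega) hi hj hrow he.symm).symm
  have hj₀ : j₀ < ω.2.arcs.length := by omega
  have hQ₀ := isolated_turn hj₀ (hsv' j₀ hj₀ hrow₀')
    (by rw [hN₀]; exact YBWalk.arcKind_ne_straight_of_S_WE (Or.inr rfl) hWE₀')
  obtain ⟨T₂, hT₂P, hT₂row, hT₂card⟩ : ∃ T₂ : Finset Face,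
      (∀ f ∈ T₂, f ∈ facesL ω.2.mids ∧ (kindsL ω.2.mids f = [.corner] ∨ kindsL ω.2.mids f = [.coCorner])) ∧
      (∀ f ∈ T₂, f.2 = Y') ∧ (2 ≤ T₂.card ∨ (1 ≤ T₂.card ∧ (ω.1 = .W ∨ ω.1 = .E) ∧ r.2 = Y')) := by
    rcases halt' with ⟨hN₁, hWE₁, -, hfne⟩ | ⟨-, hz, hrY⟩
    · have hQ₁ := isolated_turn hj₁ (hsv' j₁ hj₁ hrow₁')
        (by rw [hN₁]; exact YBWalk.arcKind_ne_straight_of_WE_S hWE₁ (Or.inr rfl))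
      refine ⟨{ω.2.fc j₀, ω.2.fc j₁}, ?_, ?_, Or.inl (by rw [Finset.card_pair hfne])⟩
      · intro f hf
        rcases Finset.mem_insert.1 hf with rfl | hf
        · exact hQ₀
        · rw [Finset.mem_singleton.1 hf]; exact hQ₁
      · intro f hf
        rcases Finset.mem_insert.1 hf with rfl | hf
        · exact hrow₀'
        · rw [Finset.mem_singleton.1 hf]; exact hrow₁'
    · exact ⟨{ω.2.fc j₀}, fun f hf => by rw [Finset.mem_singleton.1 hf]; exact hQ₀,
        fun f hf => by rw [Finset.mem_singleton.1 hf]; exact hrow₀', Or.inr ⟨by simp, hz, hrY⟩⟩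
  -- the count: the two rows are different, so the plaquettes are distinct
  have hdisj : Disjoint T₁ T₂ := by
    rw [Finset.disjoint_left]
    intro f hf₁ hf₂
    have e1 := hT₁row f hf₁; have e2 := hT₂row f hf₂; omega
  have hcard : T₁.card + T₂.card ≤ cfgCount ω.2.mids [.corner] + cfgCount ω.2.mids [.coCorner] := by
    rw [← Finset.card_union_of_disjoint hdisj]
    exact YBWalk.card_le_cfgCount_add ω.2.mids _ fun f hf => by
      rcases Finset.mem_union.1 hf with hf | hf
      · exact hT₁P f hf
      · exact hT₂P f hf
  -- at least three isolated turns, four unless the walk ends sideways in an extreme row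
  have h3 : 3 ≤ cfgCount ω.2.mids [.corner] + cfgCount ω.2.mids [.coCorner] := by
    rcases hT₁card with h1 | ⟨h1, -, hr1⟩ <;> rcases hT₂card with h2 | ⟨h2, -, hr2⟩ <;> omega
  have h4 : ¬(ω.1 = .W ∨ ω.1 = .E) → 4 ≤ cfgCount ω.2.mids [.corner] + cfgCount ω.2.mids [.coCorner] := by
    intro hnot
    rcases hT₁card with h1 | ⟨h1, hz1, -⟩ <;> rcases hT₂card with h2 | ⟨h2, hz2, -⟩
    · omega
    · exact absurd hz2 hnot
    · exact absurd hz1 hnot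
    · exact absurd hz1 hnot
  -- COST PARITY: `n_{u₁} + n_{u₂}` is even iff the end `z = r.side ω.1` is vertical like the root
  have hpar := cfgCount_corner_add_coCorner_mod_two ω.2
  obtain ⟨hvW, -, -, -⟩ := vertB_side w
  obtain ⟨hrW, hrE, hrS, hrN⟩ := vertB_side r
  rw [hvW] at hpar
  -- the end side `ω.1` (the walk `ω.2` depends on it, so we reason about it through `hds` rather than by substitution)
  have hds : ∀ s : Side, (slotDeg (slotOfSide s) = 0 ∧ vertB (r.side s) = true ∧ (s = .W ∨ s = .E)) ∨
      (slotDeg (slotOfSide s) = 1 ∧ vertB (r.side s) = false ∧ ¬(s = .W ∨ s = .E)) := by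
    intro s
    cases s
    · exact Or.inl ⟨by decide, hrW, Or.inl rfl⟩
    · exact Or.inl ⟨by decide, hrE, Or.inr rfl⟩
    · exact Or.inr ⟨by decide, hrS, by decide⟩
    · exact Or.inr ⟨by decide, hrN, by decide⟩
  rw [hcost]
  rcases hds ω.1 with ⟨hd, hv, -⟩ | ⟨hd, hv, hz⟩
  · have hp : (cfgCount ω.2.mids [.corner] + cfgCount ω.2.mids [.coCorner]) % 2 = 0 := hpar.trans (by rw [hv]; simp)
    rw [hd]; omega
  · have hp : (cfgCount ω.2.mids [.corner] + cfgCount ω.2.mids [.coCorner]) % 2 = 1 := hpar.trans (by rw [hv]; simp)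
    have := h4 hz
    rw [hd]; omega

end ΩG

end Literature.Probability.RandomPlanarGeometry.SAW.YangBaxter
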